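import Literature.Computation.Certificates.StrassmannDiscCertificate

/-!
# Chabauty–Coleman composition of Strassman disc certificates (finite bookkeeping)

The last, purely combinatorial step of a Chabauty–Coleman determination of the rational points of a curve,
typed so that a kernel-checked instance needs only the per-disc certificates:

* finitely many residue discs `i : ι`, each with a Strassman disc certificate `c i`
  (`Literature.Computation.Certificates.StrassmannDiscCert`, Boolean-checked by `decide` on literals) describing
  a coefficient sequence `a i : ℕ → ℚ_[p]` — the disc function `u ↦ Σₙ (a i n) uⁿ` on `ℤ_p`;
* a set `S` of «points» of an arbitrary type, sent to (disc, local coordinate) `∈ ι × ℤ_[p]` INJECTIVELY and INTO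
  the zero loci of the disc functions. For the rational points of a curve this map and its two properties are what
  Coleman's theorem («the rational points of a residue disc are zeros of the Coleman integral of an annihilating
  differential») and «ω kills J(ℚ)» provide — NAMED facts of the consumer, hypotheses here.

Conclusions: `S` is finite with `#S ≤ Σᵢ kᵢ` (`ncard_le_sum_k`), and a finite list of known points of that size
exhausts `S` (`eq_known_of_sum_k_le_card`) — the «sharp» case of the method.

References: R. F. Coleman, Effective Chabauty, Duke Math. J. 52 (1985) §1 (ii) (the shape of the bound
`#X(ℚ) ≤ Σ_discs #zeros`); F. Q. Gouvêa, p-adic Numbers, Thm. 5.6.1 (Strassman).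
-/

namespace Literature.Computation.Certificates.StrassmannDiscCert

open scoped BigOperators

variable {p : ℕ} [Fact p.Prime] {ι : Type*} [Fintype ι] {P : Type*}

/-- **Chabauty–Coleman composition, counting form.** Finitely many discs `i`, each with a checked Strassman disc
certificate `c i` describing the coefficients `a i` of its disc function; a set `S` of points mapped injectively to
(disc, coordinate in `ℤ_p`) and into the zeros of the disc functions. Then `S` is finite and
`#S ≤ Σᵢ (c i).k`. (For a curve: `S = X(ℚ)`, the map = reduction disc + local parameter / p, its properties =
Coleman's theorem + the annihilation of `J(ℚ)` — hypotheses `hzero`, `hinj`.)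
[cite: Coleman1985EffectiveChabauty, §1 (ii)] [cite: Gouvea1993PadicNumbers, §5.6 Thm. 5.6.1] -/
theorem ncard_le_sum_k (c : ι → StrassmannDiscCert) (hc : ∀ i, (c i).check = true)
    (a : ι → ℕ → ℚ_[p]) (ha : ∀ i, (c i).DescribesPadic (a i))
    (S : Set P) (disc : P → ι) (loc : P → ℤ_[p])
    (hzero : ∀ x ∈ S, ∑' n, a (disc x) n * ((loc x : ℤ_[p]) : ℚ_[p]) ^ n = 0)
    (hinj : S.InjOn fun x => (⟨disc x, loc x⟩ : Σ _ : ι, ℤ_[p])) :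
    S.Finite ∧ S.ncard ≤ ∑ i, (c i).k := by
  classical
  choose s hs hmem using fun i => exists_finset_zeros_padicInt (c i) (valid_of_check _ (hc i)) (ha i)
  set T : Finset (Σ _ : ι, ℤ_[p]) := Finset.univ.sigma s with hT
  set F : P → (Σ _ : ι, ℤ_[p]) := fun x => ⟨disc x, loc x⟩ with hF
  have himg : F '' S ⊆ (T : Set (Σ _ : ι, ℤ_[p])) := by
    rintro _ ⟨x, hx, rfl⟩
    simp only [hF, hT, Finset.coe_sigma, Set.mem_sigma_iff, Finset.coe_univ, Set.mem_univ, Finset.mem_coe,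
      true_and]
    exact hmem (disc x) (loc x) (hzero x hx)
  have hTfin : (T : Set (Σ _ : ι, ℤ_[p])).Finite := T.finite_toSet
  have hfinimg : (F '' S).Finite := hTfin.subset himg
  have hSfin : S.Finite := Set.Finite.of_finite_image hfinimg hinj
  refine ⟨hSfin, ?_⟩
  calc S.ncard = (F '' S).ncard := (Set.InjOn.ncard_image hinj).symm
    _ ≤ (T : Set (Σ _ : ι, ℤ_[p])).ncard := Set.ncard_le_ncard himg hTfin
    _ = T.card := Set.ncard_coe_finset T
    _ = ∑ i, (s i).card := by rw [hT, Finset.card_sigma]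
    _ ≤ ∑ i, (c i).k := Finset.sum_le_sum fun i _ => hs i

/-- **Chabauty–Coleman composition, sharp form.** In the situation of `ncard_le_sum_k`, a finite set of KNOWN
points contained in `S` whose cardinality reaches `Σᵢ (c i).k` is all of `S` («the known points are all the
rational points»). [cite: Coleman1985EffectiveChabauty, §1 (ii)] [cite: Gouvea1993PadicNumbers, §5.6 Thm. 5.6.1] -/
theorem eq_known_of_sum_k_le_card (c : ι → StrassmannDiscCert) (hc : ∀ i, (c i).check = true)
    (a : ι → ℕ → ℚ_[p]) (ha : ∀ i, (c i).DescribesPadic (a i))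
    (S : Set P) (disc : P → ι) (loc : P → ℤ_[p])
    (hzero : ∀ x ∈ S, ∑' n, a (disc x) n * ((loc x : ℤ_[p]) : ℚ_[p]) ^ n = 0)
    (hinj : S.InjOn fun x => (⟨disc x, loc x⟩ : Σ _ : ι, ℤ_[p]))
    (known : Finset P) (hknown : (known : Set P) ⊆ S) (hcard : ∑ i, (c i).k ≤ known.card) :
    S = known := by
  obtain ⟨hfin, hle⟩ := ncard_le_sum_k c hc a ha S disc loc hzero hinj
  refine (Set.eq_of_subset_of_ncard_le hknown ?_ hfin).symm
  calc S.ncard ≤ ∑ i, (c i).k := hle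
    _ ≤ known.card := hcard
    _ = (known : Set P).ncard := (Set.ncard_coe_finset known).symm

/-- **Chabauty–Coleman composition with certified NON-rational zeros.** In the situation of `ncard_le_sum_k`, suppose
that for each disc `i` a finite set `Z i ⊂ ℤ_p` of zeros of the disc function is known whose elements are NOT the
coordinates of points of `S` in that disc — e.g. the parameter `0` of a disc based at an IRRATIONAL Weierstrass point
(the disc function `∫` from the base vanishes at the base, which is not a rational point). Then those zeros are
spent: `#S + Σᵢ #Zᵢ ≤ Σᵢ kᵢ` (kind CC 0.4 of `pub/certnum/nt/FORMAT-ratpcert-v0.md` §17.4, «irrational Weierstrass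
base»: rational points of such a disc `≤ k − 1`). [cite: Coleman1985EffectiveChabauty, §1 (ii)]
[cite: Gouvea1993PadicNumbers, §5.6 Thm. 5.6.1] -/
theorem ncard_add_card_le_sum_k (c : ι → StrassmannDiscCert) (hc : ∀ i, (c i).check = true)
    (a : ι → ℕ → ℚ_[p]) (ha : ∀ i, (c i).DescribesPadic (a i))
    (S : Set P) (disc : P → ι) (loc : P → ℤ_[p])
    (hzero : ∀ x ∈ S, ∑' n, a (disc x) n * ((loc x : ℤ_[p]) : ℚ_[p]) ^ n = 0)
    (hinj : S.InjOn fun x => (⟨disc x, loc x⟩ : Σ _ : ι, ℤ_[p]))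
    (Z : ι → Finset ℤ_[p]) (hZ : ∀ i, ∀ z ∈ Z i, ∑' n, a i n * ((z : ℤ_[p]) : ℚ_[p]) ^ n = 0)
    (hZS : ∀ x ∈ S, loc x ∉ Z (disc x)) :
    S.Finite ∧ S.ncard + ∑ i, (Z i).card ≤ ∑ i, (c i).k := by
  classical
  choose s hs hmem using fun i => exists_finset_zeros_padicInt (c i) (valid_of_check _ (hc i)) (ha i)
  set T : Finset (Σ _ : ι, ℤ_[p]) := Finset.univ.sigma s with hT
  set F : P → (Σ _ : ι, ℤ_[p]) := fun x => ⟨disc x, loc x⟩ with hF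
  have himg : F '' S ⊆ (T : Set (Σ _ : ι, ℤ_[p])) := by
    rintro _ ⟨x, hx, rfl⟩
    simp only [hF, hT, Finset.coe_sigma, Set.mem_sigma_iff, Finset.coe_univ, Set.mem_univ, Finset.mem_coe,
      true_and]
    exact hmem (disc x) (loc x) (hzero x hx)
  have hTfin : (T : Set (Σ _ : ι, ℤ_[p])).Finite := T.finite_toSet
  have hfinimg : (F '' S).Finite := hTfin.subset himg
  have hSfin : S.Finite := Set.Finite.of_finite_image hfinimg hinj
  refine ⟨hSfin, ?_⟩
  set A : Finset (Σ _ : ι, ℤ_[p]) := hfinimg.toFinset with hA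
  set ZZ : Finset (Σ _ : ι, ℤ_[p]) := Finset.univ.sigma Z with hZZ
  have hAT : A ⊆ T := by
    intro y hy
    rw [hA, Set.Finite.mem_toFinset] at hy
    exact himg hy
  have hZT : ZZ ⊆ T := by
    rintro ⟨i, z⟩ hz
    simp only [hZZ, Finset.mem_sigma, Finset.mem_univ, true_and] at hz
    simp only [hT, Finset.mem_sigma, Finset.mem_univ, true_and]
    exact hmem i z (hZ i z hz)
  have hdisj : Disjoint A ZZ := by
    rw [Finset.disjoint_left]
    rintro ⟨i, z⟩ hyA hyZ
    rw [hA, Set.Finite.mem_toFinset] at hyA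
    obtain ⟨x, hx, hxe⟩ := hyA
    simp only [hZZ, Finset.mem_sigma, Finset.mem_univ, true_and] at hyZ
    have h1 : disc x = i := congrArg Sigma.fst hxe
    subst h1
    have h2 : loc x = z := eq_of_heq (Sigma.mk.inj hxe).2
    exact hZS x hx (h2 ▸ hyZ)
  have hcardS : S.ncard = A.card := by
    rw [← Set.InjOn.ncard_image hinj, hA]
    exact Set.ncard_eq_toFinset_card _ hfinimg
  have hcardZ : ZZ.card = ∑ i, (Z i).card := by rw [hZZ, Finset.card_sigma]
  calc S.ncard + ∑ i, (Z i).card = (A ∪ ZZ).card := by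
        rw [Finset.card_union_of_disjoint hdisj, hcardS, hcardZ]
    _ ≤ T.card := Finset.card_le_card (Finset.union_subset hAT hZT)
    _ = ∑ i, (s i).card := by rw [hT, Finset.card_sigma]
    _ ≤ ∑ i, (c i).k := Finset.sum_le_sum fun i _ => hs i

end Literature.Computation.Certificates.StrassmannDiscCert
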